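import Summits.ABC.IUTFork.Repair.RHReachLedgerDoorLocal
import Summits.ABC.IUTFork.Repair.RHReachLedgerDoorGenuine
import Literature.IUT.LogVolume.UnitLogValuationSpectrum
import HarnessLib

/-!
# R-H ROUND 2, row 27 «reach-ledger» — THE ROW-27 DOOR AT THE GENUINE BED with the two CERTIFICATES DISCHARGED IN KERNEL at every
# bad prime off the ties: `HStarReachLedgerK ∧ (uniform fibres, (p−1) ∤ e_p at the bad primes) ∧ integer Kummer orders ⟹ Statement`

PROOF-ONLY file (0 definitions, 0 `Prop` facts; abc-iut cell, D-0079 RESCUE sub-cell R-H, rung LADDER-ABC:A2.RESCUE.H; ROUND-2 seat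
abc-iut-rh2-L1 gen 2). TAKES NO SIDE on [IUTchIII] Cor. 3.12 or on any author (Mochizuki / Scholze–Stix / Joshi / Dupuy–Hilado); row 27's
ledger `RH.ReachLedger.HStarReachLedgerK` (abc-iut-lens-nearmiss-1, p464022) is an R-H CANDIDATE = a HYPOTHESIS SHAPE, never asserted; typed ≠
proved; instantiated ≠ endorsed; nothing here asserts abc proved or refuted.

THE RESIDUAL BINDERS OF RECORD (gen 0, 2026-08-26T23:58:16Z; abc-iut-rh-typ-10's `RH.ReachLedgerQ2.k2Target27_of_certificates`, p47xxxx) at a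
genuine datum were: a certified UNIFORM dictionary AT EVERY PRIME `p` — `e(𝔭_x∣p) = e_p`, an inner certificate `A_p` (a NON-log-unit of norm
`≤ p^{−(A_p−1)/e_p}` at every `x ∣ p`), an outer certificate `B_p ≤ A_p` (a log-unit of norm `≥ p^{−B_p/e_p}`), and `innerCond ≤ A_p`,
`B_p ≤ rOutSharp` at the bad places. THIS FILE DISCHARGES THEM: by the W-relative door (`ReachLedgerDoor.statement_of_hStarReachLedger_on`,
`Repair/RHReachLedgerDoorLocal.lean`) nothing is asked at a prime without a bad place, and at a prime `p` UNDER a bad place with uniform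
index `e_p` OFF THE INNER TIE (`(p−1) ∤ e_p`; this already excludes the cyclotomic outer ties `e_p = p^a(p−1)`) the certificates at the
ledger's own column values EXIST IN KERNEL at every `x ∣ p`:
* inner, `A_p := ⌊e_p/(p−1)⌋ + 1 = innerCond p e_p`: the ball `{‖z‖ ≤ ‖ϖ_x‖^{⌊e_p/(p−1)⌋}}` is NOT inside `log_p(𝒪_x^×)` — campaign-S
  `LogEnvelope.not_closedBall_div_subset_logUnits` (`ϖ^{⌊e/(p−1)⌋}` is not a unit logarithm, Neukirch II (5.5));
* outer, `B_p := p^{a₀} − e_p·a₀` at the strict turning point `a₀` of `e_p`: `log_p(1 + ϖ_x)` has exactly that norm — abc-iut-rh-typ-12's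
  `RHSlotReach.exists_hrad_sharp` over `LogEnvelope.exists_mem_logUnits_norm_eq_envelope`; and `B_p ≤ rOutSharp p e_p = min_t (p^t − t·e_p)`
  because the turning point MINIMISES `t ↦ p^t − t·e_p` (`RamificationCriterion.exponent_min`) — `envelope_le_rOutSharp` (§0).
WHAT IS PROVED. **`statement_pilotDataOfK_of_hStarReachLedgerK_untied`**: at the genuine bed `Cor312Prov.pilotDataOfK D K` with REALISING ideles
(`ht`/`htq`, inhabited by `Cor312Prov.exists_realising_{theta,q}Ideles_pilotDataOfK`): IF at every prime `p` under a bad place the fibre of `K` is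
UNIFORM (`e(𝔭_x∣p) = e_p` for all `x ∣ p`) and UNTIED (`(p−1) ∤ e_p`), the Kummer orders at the bad places are the integers `m_q(w) = P_q(w)`, and
row 27's ledger `HStarReachLedgerK D e m_q` holds at the intrinsic index, THEN the typed [IUTchIII] Cor. 3.12 `Statement` of
`settingPrVolSharp (pilotDataOfK D K) …` holds — NO certificate binder left. `…_untied'`: the same with uniformity stated intrinsically
(`e(𝔭_x∣p) = e(𝔭_w∣p)` for `x, w ∣ p`, `w` bad). So `K2Target27` is closed BY NAME on every Σ₂₇ datum whose bad primes are uniform and untied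
(sequel: the `T.Cor312NonarchOf` / `K2Target27` corollaries over abc-iut-rh-typ-10's last arrow); OPEN exactly at data with a non-uniform or TIED
bad prime (inner `(p−1) ∣ e_w`, e.g. any bad place over `2`; the tie files `UnitLogInnerRadiusTie*` / `UnitLogTieAttained` are the next door).
HONEST SCOPE. OUR typed objects (Dupuy–Hilado (Ind2) = all `ℤ_p`-lattice automorphisms — STRONGER-THAN-PRINT; sharp boxes; hull-level (xi-f)); which
genuine data satisfy H⋆₂₇ is abc-iut-rh-num-1's table; «Statement follows from the ledger AS TYPED», nothing more.
[cite: NeukirchANT1999, Ch. II (5.5), Prop. (6.8)] [cite: DupuyHilado2025, §3.3, §3.4, §3.6, §3.9, §4.9]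
[cite: Mochizuki2012, IUTchI Ex. 3.2 (iv) p. 71; IUTchIII Rmk. 3.9.3 pp. 119–120, Cor. 3.12 p. 173–174] [claim: Mochizuki2012, status: disputed]
-/

noncomputable section

open Set Function Metric
open scoped Pointwise

namespace Summit.ABC.IUTFork.Repair.RH.ReachLedgerDoor

open Thm311 Thm311.Real Cor312 Cor312.Setting Cor312Vol Cor312Prov Literature.IUT.LogThetaLattice Literature.IUT.LogVolume
  Literature.IUT.HodgeTheaters Summit.ABC.IUTFork.Repair.RH.ReachLedger
open Literature.NumberTheory.NumberFields NumberField IsDedekindDomain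
open Literature.NumberTheory.GaloisRepresentations.Ultrametric

/-! ## §0. The turning-point value is below every `p^t − t·e`, hence below `rOutSharp` -/

/-- **`p^{a₀} − e·a₀ ≤ r_out♯(p,e) = min_{0≤t≤e} (p^t − t·e)`** at a turning point `a₀` of `e` (`p^a(p−1) < e` for `a < a₀`, `e ≤ p^{a₀}(p−1)`):
the turning point minimises `t ↦ p^t − t·e` over ALL `t` (`RamificationCriterion.exponent_min`), in particular over the fold's range and its
seed `1 = p^0 − 0`. [cite: NeukirchANT1999, Ch. II (5.5)] -/
theorem envelope_le_rOutSharp {p : ℕ} (hp : p.Prime) {e a₀ : ℕ}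
    (hlo : ∀ a < a₀, (p : ℤ) ^ a * ((p : ℤ) - 1) < e) (hhi : (e : ℤ) ≤ (p : ℤ) ^ a₀ * ((p : ℤ) - 1)) :
    (p : ℤ) ^ a₀ - (e : ℤ) * (a₀ : ℤ) ≤ rOutSharp p e := by
  have hmin : ∀ t : ℕ, (p : ℤ) ^ a₀ - (e : ℤ) * (a₀ : ℤ) ≤ (p : ℤ) ^ t - (t : ℤ) * (e : ℤ) := fun t => by
    have h := RamificationCriterion.exponent_min (S := 1) (P := (p : ℤ)) (E := (e : ℤ)) (a₀ := a₀) le_rfl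
      (by exact_mod_cast hp.two_le) (fun a ha => by rw [one_mul]; exact hlo a ha) (by rw [one_mul]; exact hhi) t
    rw [one_mul, one_mul] at h
    linarith [mul_comm (e : ℤ) (t : ℤ)]
  unfold rOutSharp
  suffices hfold : ∀ (l : List ℤ) (a : ℤ), (p : ℤ) ^ a₀ - (e : ℤ) * (a₀ : ℤ) ≤ a →
      (∀ x ∈ l, (p : ℤ) ^ a₀ - (e : ℤ) * (a₀ : ℤ) ≤ x) → (p : ℤ) ^ a₀ - (e : ℤ) * (a₀ : ℤ) ≤ l.foldl min a by
    refine hfold _ 1 (by simpa using hmin 0) fun x hx => ?_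
    obtain ⟨t, -, rfl⟩ := List.mem_map.mp hx
    exact hmin t
  intro l
  induction l with
  | nil => intro a ha _; simpa using ha
  | cons x l ih =>
    intro a ha hl
    rw [List.foldl_cons]
    exact ih _ (le_min ha (hl x (by simp))) fun y hy => hl y (by simp [hy])

/-! ## §1. The row-27 door at the genuine bed, certificates DISCHARGED off the ties -/

section GenuineUntied

variable {F K Fbar : Type} [Field F] [NumberField F] [Field K] [NumberField K] [Algebra F K] [Field Fbar]
  [Algebra F Fbar] [Algebra K Fbar] {E : WeierstrassCurve F} [E.IsElliptic] {l : ℕ} {Pb : BadPlacePredicates K}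
  (D : InitialThetaData F K Fbar E l Pb) {logv : PadicLogs K} (hlog : LogvAnalytic logv)
  (M : Type) [Field M] [NumberField M]
  (archPk : ∀ (j : (thetaIndex (pilotDataOfK D K)).Label) (vQ : (thetaIndex (pilotDataOfK D K)).VQ),
    Set ((logShellsDH (pilotDataOfK D K) logv).Packet j vQ))
  (archSub : ∀ (j : (thetaIndex (pilotDataOfK D K)).Label) (v : (thetaIndex (pilotDataOfK D K)).V),
    Set ((logShellsDH (pilotDataOfK D K) logv).Packet j ((thetaIndex (pilotDataOfK D K)).over v)))
  (Ψ : ℤ → ∀ v : (thetaIndex (pilotDataOfK D K)).V, v ∈ (thetaIndex (pilotDataOfK D K)).Vbad →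
    Set ((logShellsDH (pilotDataOfK D K) logv).StarPacket v))
  (act : ℤ → ∀ v : (thetaIndex (pilotDataOfK D K)).V, v ∈ (thetaIndex (pilotDataOfK D K)).Vbad →
    (logShellsDH (pilotDataOfK D K) logv).StarPacket v → Module.End ℚ ((logShellsDH (pilotDataOfK D K) logv).StarPacket v))
  (Mmod : ℤ → ∀ j : (thetaIndex (pilotDataOfK D K)).LabelStar, Set ((logShellsDH (pilotDataOfK D K) logv).GlobalPacket j.1))
  (region : ℤ → ∀ j : (thetaIndex (pilotDataOfK D K)).LabelStar, FinDivisor M → ∀ vQ : (thetaIndex (pilotDataOfK D K)).VQ,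
    Set ((logShellsDH (pilotDataOfK D K) logv).Packet j.1 vQ))
  (n : ℤ) {HT : Type} {LogLink : HT → HT → Type} {IsFull : ∀ {s t : HT}, LogLink s t → Prop}
  (lat : LGPGaussianLogThetaLattice LogLink IsFull)
  {Frd : Type} {IsoF : Frd → Frd → Type} {Ob : Frd → Type} {realify : Frd → Frd} {Strip : Type}
  {IsoS : Strip → Strip → Type}
  {Mv : ∀ v : (thetaIndex (pilotDataOfK D K)).V, v ∈ (thetaIndex (pilotDataOfK D K)).Vbad → Type} [∀ v h, Monoid (Mv v h)]
  (sig : GlobalLGPFrobenioidSignature (thetaIndex (pilotDataOfK D K)).lstar (thetaIndex (pilotDataOfK D K)).V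
    (· ∈ (thetaIndex (pilotDataOfK D K)).Vbad) Frd IsoF Ob realify Strip IsoS Mv)
  (split : SplittingMonoids Mv) {ObΔ : Type}
  {N : ∀ v : (thetaIndex (pilotDataOfK D K)).V, v ∈ (thetaIndex (pilotDataOfK D K)).Vbad → Type} [∀ v h, Monoid (N v h)]
  (qData : QPilotData ObΔ N)
  (tq : ∀ (pp : Nat.Primes) (x : (thetaIndex (pilotDataOfK D K)).Fibre (.inr pp)),
    haveI : Fact (pp : ℕ).Prime := ⟨pp.2⟩; kOf (pilotDataOfK D K) pp.1 x)
  (t : ∀ (pp : Nat.Primes) (_ : Fin (pilotDataOfK D K).lstar) (x : (thetaIndex (pilotDataOfK D K)).Fibre (.inr pp)),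
    haveI : Fact (pp : ℕ).Prime := ⟨pp.2⟩; kOf (pilotDataOfK D K) pp.1 x)
  (htq0 : ∀ pp x, tq pp x ≠ 0)
  (htq1 : ∀ (pp : Nat.Primes) (x : (thetaIndex (pilotDataOfK D K)).Fibre (.inr pp)),
    haveI : Fact (pp : ℕ).Prime := ⟨pp.2⟩; placeOf (pilotDataOfK D K) pp.1 x ∉ (pilotDataOfK D K).S → ‖tq pp x‖ = 1)
  (ht0 : ∀ pp i x, t pp i x ≠ 0)
  (ht1 : ∀ (pp : Nat.Primes) (i : Fin (pilotDataOfK D K).lstar) (x : (thetaIndex (pilotDataOfK D K)).Fibre (.inr pp)),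
    haveI : Fact (pp : ℕ).Prime := ⟨pp.2⟩; placeOf (pilotDataOfK D K) pp.1 x ∉ (pilotDataOfK D K).S → ‖t pp i x‖ = 1)
  (ht : ∀ (pp : Nat.Primes) (i : Fin (pilotDataOfK D K).lstar) (x : (thetaIndex (pilotDataOfK D K)).Fibre (.inr pp)),
    haveI : Fact (pp : ℕ).Prime := ⟨pp.2⟩
    Real.log ‖t pp i x‖ = -((pilotDataOfK D K).thetaPilot i (placeOf (pilotDataOfK D K) pp.1 x)) *
      logNorm K (placeOf (pilotDataOfK D K) pp.1 x) / localDegree K (placeOf (pilotDataOfK D K) pp.1 x))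
  (htq : ∀ (pp : Nat.Primes) (x : (thetaIndex (pilotDataOfK D K)).Fibre (.inr pp)),
    haveI : Fact (pp : ℕ).Prime := ⟨pp.2⟩
    Real.log ‖tq pp x‖ = -((pilotDataOfK D K).qPilot (placeOf (pilotDataOfK D K) pp.1 x)) *
      logNorm K (placeOf (pilotDataOfK D K) pp.1 x) / localDegree K (placeOf (pilotDataOfK D K) pp.1 x))
  (mq : ∀ pp : Nat.Primes, (thetaIndex (pilotDataOfK D K)).Fibre (.inr pp) → ℤ)

include ht0 ht1 ht htq in
/-- **THE ROW-27 DOOR AT THE GENUINE BED, CERTIFICATES DISCHARGED OFF THE TIES.** At `pilotDataOfK D K` ([IUTchI] Ex. 3.2 (iv)) with Θ- and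
q-ideles REALISING the pilot divisors (`ht`/`htq`, nonzero, units off `S`): IF every prime `p` lying under a bad place has a UNIFORM fibre
(`e(𝔭_x ∣ p) = e_p` for all `x ∣ p`) that is UNTIED (`(p−1) ∤ e_p`), the Kummer orders at the bad places are the integers `m_q(w) = P_q(w)`, and
row 27's candidate `HStarReachLedgerK D e m_q` holds at the intrinsic index `e(x) = e(𝔭_x ∣ p)`, THEN the typed [IUTchIII] Cor. 3.12 `Statement` of
`settingPrVolSharp (pilotDataOfK D K) … tq t …` holds (ANY columns / context data). The certificates are THEOREMS here: inner at
`A_p = ⌊e_p/(p−1)⌋ + 1` (`LogEnvelope.not_closedBall_div_subset_logUnits`), outer at `B_p = p^{a₀} − e_p·a₀ ≤ rOutSharp p e_p`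
(`RHSlotReach.exists_hrad_sharp`, §0); the setting's binders as in gen 0 (`bridgeHyps_settingPrVolSharp_of_ideles`, `RH2SigmaHull.exists_normUniformizers`,
`norm_{theta,q}Idele_eq_zpow_of_realises`). «Statement follows from the ledger AS TYPED»; which data satisfy the ledger is rh-num-1's table.
[cite: NeukirchANT1999, Ch. II (5.5), Prop. (6.8)] [cite: DupuyHilado2025, §3.3, §3.4, §3.9, §4.9] [cite: Mochizuki2012, IUTchI Ex. 3.2 (iv) p. 71;
IUTchIII Cor. 3.12 p. 173–174] [claim: Mochizuki2012, status: disputed] -/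
theorem statement_pilotDataOfK_of_hStarReachLedgerK_untied (eK : Nat.Primes → ℕ)
    (heK : ∀ (pp : Nat.Primes) (w : (thetaIndex (pilotDataOfK D K)).Fibre (.inr pp)), haveI : Fact (pp : ℕ).Prime := ⟨pp.2⟩
      placeOf (pilotDataOfK D K) pp.1 w ∈ (pilotDataOfK D K).S → ∀ x : (thetaIndex (pilotDataOfK D K)).Fibre (.inr pp),
        (placeOf (pilotDataOfK D K) pp.1 x).asIdeal.ramificationIdx ℤ = eK pp)
    (hnd : ∀ (pp : Nat.Primes) (w : (thetaIndex (pilotDataOfK D K)).Fibre (.inr pp)), haveI : Fact (pp : ℕ).Prime := ⟨pp.2⟩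
      placeOf (pilotDataOfK D K) pp.1 w ∈ (pilotDataOfK D K).S → ¬ ((pp : ℕ) - 1 ∣ eK pp))
    (hmq : ∀ (pp : Nat.Primes) (w : (thetaIndex (pilotDataOfK D K)).Fibre (.inr pp)), haveI : Fact (pp : ℕ).Prime := ⟨pp.2⟩
      placeOf (pilotDataOfK D K) pp.1 w ∈ (pilotDataOfK D K).S →
        (mq pp w : ℝ) = (pilotDataOfK D K).qPilot (placeOf (pilotDataOfK D K) pp.1 w))
    (hH : HStarReachLedgerK D
      (fun pp x => haveI : Fact (pp : ℕ).Prime := ⟨pp.2⟩; (placeOf (pilotDataOfK D K) pp.1 x).asIdeal.ramificationIdx ℤ) mq) :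
    (settingPrVolSharp (pilotDataOfK D K) hlog M archPk archSub Ψ act Mmod region n lat sig split qData tq t htq0 htq1).Statement := by
  haveI hne : ∀ pp : Nat.Primes, Fact (pp : ℕ).Prime := fun pp => ⟨pp.2⟩
  classical
  obtain ⟨ϖ, hϖ⟩ := RH2SigmaHull.exists_normUniformizers D
  -- a turning point `a₀(p)` of `e_p` at every prime
  have hturn : ∀ pp : Nat.Primes, ∃ a₀ : ℕ, (∀ a < a₀, ((pp : ℕ) : ℤ) ^ a * (((pp : ℕ) : ℤ) - 1) < eK pp) ∧
      ((eK pp : ℕ) : ℤ) ≤ ((pp : ℕ) : ℤ) ^ a₀ * (((pp : ℕ) : ℤ) - 1) :=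
    fun pp => LogEnvelope.exists_turning (p := (pp : ℕ)) (eK pp)
  choose a₀ ha₀lo ha₀hi using hturn
  -- the certified columns: `A_p := ⌊e_p/(p−1)⌋ + 1 = innerCond` (off the tie), `B_p := p^{a₀} − e_p·a₀ ≤ rOutSharp`
  let AK : Nat.Primes → ℕ := fun pp => eK pp / ((pp : ℕ) - 1) + 1
  let BK : Nat.Primes → ℤ := fun pp => ((pp : ℕ) : ℤ) ^ a₀ pp - (eK pp : ℤ) * (a₀ pp : ℤ)
  have hAK1 : ∀ pp, (AK pp : ℤ) - 1 = ((eK pp / ((pp : ℕ) - 1) : ℕ) : ℤ) := fun pp => by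
    show (((eK pp / ((pp : ℕ) - 1) + 1 : ℕ) : ℤ)) - 1 = _
    push_cast
    ring
  -- readings of the index: `e(K_x/ℚ_p) = e(𝔭_x∣p) = ramIdx`, `= e_p` at a bad prime
  have hidx : ∀ (pp : Nat.Primes) (x : (thetaIndex (pilotDataOfK D K)).Fibre (.inr pp)),
      absRamificationIdx (pp : ℕ) (kOf (pilotDataOfK D K) pp.1 x) = (placeOf (pilotDataOfK D K) pp.1 x).asIdeal.ramificationIdx ℤ :=
    fun pp x => absRamificationIdx_rescaledCompletion K pp.1 (placeOf (pilotDataOfK D K) pp.1 x) (natCast_mem_placeOf (pilotDataOfK D K) pp.1 x)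
  have hϖ0 : ∀ pp x, ϖ pp x ≠ 0 := fun pp x => by
    rw [← norm_pos_iff, hϖ pp x]; exact Real.rpow_pos_of_pos (by exact_mod_cast pp.2.pos) _
  have hϖ' : ∀ (pp : Nat.Primes) (w : (thetaIndex (pilotDataOfK D K)).Fibre (.inr pp)),
      placeOf (pilotDataOfK D K) pp.1 w ∈ (pilotDataOfK D K).S → ∀ x : (thetaIndex (pilotDataOfK D K)).Fibre (.inr pp),
        ‖ϖ pp x‖ = ((pp : ℕ) : ℝ) ^ (-(1 : ℝ) / (eK pp : ℝ)) := fun pp w hw x => by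
    rw [hϖ pp x, ramIdx_eq, heK pp w hw x]
  have he : ∀ (pp : Nat.Primes) (w : (thetaIndex (pilotDataOfK D K)).Fibre (.inr pp)),
      placeOf (pilotDataOfK D K) pp.1 w ∈ (pilotDataOfK D K).S → 1 ≤ eK pp := fun pp w hw => by
    have h1 := RH2SigmaHull.one_le_ramIdx_placeOf D pp w
    rw [ramIdx_eq, heK pp w hw w] at h1
    exact h1
  refine statement_of_hStarReachLedger_on (pilotDataOfK D K) hlog M archPk archSub Ψ act Mmod region n lat sig split qData tq t htq0 htq1
    eK AK BK ϖ (fun pp i w => ((((i : ℕ) : ℤ) + 1) ^ 2) * mq pp w) mq ht0 hϖ0 ht1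
    (fun pp i w hw => RH2SigmaHull.norm_thetaIdele_eq_zpow_of_realises D tq t htq0 ht0 ht htq mq pp i w (ϖ pp w) (hϖ pp w) (hmq pp w hw))
    (fun pp w hw => RH2SigmaHull.norm_qIdele_eq_zpow_of_realises D tq htq0 htq mq pp w (ϖ pp w) (hϖ pp w) (hmq pp w hw))
    (fun pp i w _ => rfl) he hϖ' (fun pp w hw x => ?_) (fun pp w hw x => ?_) (fun pp w hw => ?_) (fun pp w hw => ?_)
    (fun pp x => (placeOf (pilotDataOfK D K) pp.1 x).asIdeal.ramificationIdx ℤ) (fun pp w hw => heK pp w hw w) hH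
    (bridgeHyps_settingPrVolSharp_of_ideles (pilotDataOfK D K) hlog M archPk archSub Ψ act Mmod region n lat sig split qData t tq ht0 ht1
      htq0 htq1)
  · -- INNER certificate at `A_p = ⌊e_p/(p−1)⌋ + 1`: the ball of exponent `⌊e_p/(p−1)⌋` is not inside `log_p(𝒪_x^×)`
    have hu : IsUniformizer (unifChoice (kOf (pilotDataOfK D K) pp.1 x)) := isUniformizer_unifChoice _
    have hex : absRamificationIdx (pp : ℕ) (kOf (pilotDataOfK D K) pp.1 x) = eK pp := (hidx pp x).trans (heK pp w hw x)
    have hns := LogEnvelope.not_closedBall_div_subset_logUnits (pp : ℕ) hu (by rw [hex]; exact hnd pp w hw)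
    rw [hex] at hns
    obtain ⟨u, hu_mem, hu_not⟩ := Set.not_subset.mp hns
    refine ⟨u, ?_, hu_not⟩
    have hnorm : ‖(unifChoice (kOf (pilotDataOfK D K) pp.1 x) : kOf (pilotDataOfK D K) pp.1 x)‖ = ‖ϖ pp x‖ := by
      rw [norm_eq_rpow_of_isUniformizer (pp : ℕ) (kOf (pilotDataOfK D K) pp.1 x) hu, hex, hϖ' pp w hw x, neg_div]
    rw [hAK1 pp, zpow_natCast, ← hnorm]
    exact mem_closedBall_zero_iff.mp hu_mem
  · -- OUTER certificate at `B_p = p^{a₀} − e_p·a₀`: `log_p(1 + ϖ_x)` (strict turning point, no tie)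
    have hu : IsUniformizer (unifChoice (kOf (pilotDataOfK D K) pp.1 x)) := isUniformizer_unifChoice _
    have hex : absRamificationIdx (pp : ℕ) (kOf (pilotDataOfK D K) pp.1 x) = eK pp := (hidx pp x).trans (heK pp w hw x)
    have hhi' : ((eK pp : ℕ) : ℤ) < ((pp : ℕ) : ℤ) ^ a₀ pp * (((pp : ℕ) : ℤ) - 1) := by
      have h := LogEnvelope.lt_of_le_of_not_dvd (hnd pp w hw) (s := 1) le_rfl (a₀ := a₀ pp) (by rw [one_mul]; exact ha₀hi pp)
      rwa [one_mul] at h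
    obtain ⟨z, hz, hzn⟩ := RHSlotReach.exists_hrad_sharp (pp : ℕ) (kOf (pilotDataOfK D K) pp.1 x) hu (a₀ := a₀ pp)
      (by rw [hex]; exact ha₀lo pp) (by rw [hex]; exact hhi')
    rw [hex] at hzn
    exact ⟨z, hz, hzn⟩
  · -- the inner column IS `A_p` off the tie
    show innerCond pp (eK pp) ≤ (((eK pp / ((pp : ℕ) - 1) + 1 : ℕ) : ℤ))
    unfold innerCond
    rw [if_neg (hnd pp w hw)]
    push_cast
    exact le_rfl
  · -- the outer column dominates `B_p` (§0)
    exact envelope_le_rOutSharp pp.2 (ha₀lo pp) (ha₀hi pp)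

include ht0 ht1 ht htq in
/-- **The same with UNIFORMITY STATED INTRINSICALLY** (no index function): at every prime under a bad place `w` all fibre points have the
ramification index of `w`, and `(p−1) ∤ e(𝔭_w ∣ p)`. [cite: NeukirchANT1999, Ch. II (5.5)] [cite: Mochizuki2012, IUTchI Ex. 3.2 (iv) p. 71;
IUTchIII Cor. 3.12 p. 173–174] [claim: Mochizuki2012, status: disputed] -/
theorem statement_pilotDataOfK_of_hStarReachLedgerK_untied'
    (huni : ∀ (pp : Nat.Primes) (w x : (thetaIndex (pilotDataOfK D K)).Fibre (.inr pp)), haveI : Fact (pp : ℕ).Prime := ⟨pp.2⟩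
      placeOf (pilotDataOfK D K) pp.1 w ∈ (pilotDataOfK D K).S →
        (placeOf (pilotDataOfK D K) pp.1 x).asIdeal.ramificationIdx ℤ = (placeOf (pilotDataOfK D K) pp.1 w).asIdeal.ramificationIdx ℤ)
    (hnd : ∀ (pp : Nat.Primes) (w : (thetaIndex (pilotDataOfK D K)).Fibre (.inr pp)), haveI : Fact (pp : ℕ).Prime := ⟨pp.2⟩
      placeOf (pilotDataOfK D K) pp.1 w ∈ (pilotDataOfK D K).S →
        ¬ ((pp : ℕ) - 1 ∣ (placeOf (pilotDataOfK D K) pp.1 w).asIdeal.ramificationIdx ℤ))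
    (hmq : ∀ (pp : Nat.Primes) (w : (thetaIndex (pilotDataOfK D K)).Fibre (.inr pp)), haveI : Fact (pp : ℕ).Prime := ⟨pp.2⟩
      placeOf (pilotDataOfK D K) pp.1 w ∈ (pilotDataOfK D K).S →
        (mq pp w : ℝ) = (pilotDataOfK D K).qPilot (placeOf (pilotDataOfK D K) pp.1 w))
    (hH : HStarReachLedgerK D
      (fun pp x => haveI : Fact (pp : ℕ).Prime := ⟨pp.2⟩; (placeOf (pilotDataOfK D K) pp.1 x).asIdeal.ramificationIdx ℤ) mq) :
    (settingPrVolSharp (pilotDataOfK D K) hlog M archPk archSub Ψ act Mmod region n lat sig split qData tq t htq0 htq1).Statement := by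
  haveI hne : ∀ pp : Nat.Primes, Fact (pp : ℕ).Prime := fun pp => ⟨pp.2⟩
  classical
  -- the index at a bad prime, read off any bad fibre point (junk `0` at a prime with no bad place — never read)
  let eK : Nat.Primes → ℕ := fun pp =>
    if h : ∃ w : (thetaIndex (pilotDataOfK D K)).Fibre (.inr pp), placeOf (pilotDataOfK D K) pp.1 w ∈ (pilotDataOfK D K).S then
      (placeOf (pilotDataOfK D K) pp.1 h.choose).asIdeal.ramificationIdx ℤ else 0
  have heK : ∀ (pp : Nat.Primes) (w : (thetaIndex (pilotDataOfK D K)).Fibre (.inr pp)),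
      placeOf (pilotDataOfK D K) pp.1 w ∈ (pilotDataOfK D K).S → ∀ x : (thetaIndex (pilotDataOfK D K)).Fibre (.inr pp),
        (placeOf (pilotDataOfK D K) pp.1 x).asIdeal.ramificationIdx ℤ = eK pp := by
    intro pp w hw x
    have h : ∃ w : (thetaIndex (pilotDataOfK D K)).Fibre (.inr pp), placeOf (pilotDataOfK D K) pp.1 w ∈ (pilotDataOfK D K).S := ⟨w, hw⟩
    show _ = (if h : ∃ w : (thetaIndex (pilotDataOfK D K)).Fibre (.inr pp), placeOf (pilotDataOfK D K) pp.1 w ∈ (pilotDataOfK D K).S then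
      (placeOf (pilotDataOfK D K) pp.1 h.choose).asIdeal.ramificationIdx ℤ else 0)
    rw [dif_pos h, huni pp _ x h.choose_spec]
  refine statement_pilotDataOfK_of_hStarReachLedgerK_untied D hlog M archPk archSub Ψ act Mmod region n lat sig split qData tq t htq0 htq1
    ht0 ht1 ht htq mq eK heK (fun pp w hw => ?_) hmq hH
  rw [← heK pp w hw w]
  exact hnd pp w hw

end GenuineUntied

end Summit.ABC.IUTFork.Repair.RH.ReachLedgerDoor

end
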